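import Summits.Ventures.PercRepro.Night2ThreeTwoGeneric
import Summits.Ventures.PercRepro.Night2ThreeOneFatResidues

/-!
# PercRepro — the `(7, 5)` shadow row modulo the residues U: the cell `(3, 2)` shrinks to its structured part
(night-2, gen 24)

`shadowHall_seven_five_of_residuesU`: `ShadowHall M 7 5 (phiK 7 5)` for every finite matroid modulo `(2, 0)`,
`(2, 1)` (as in the residues T) and the STRUCTURED part of `(3, 2)`: a fat non-basis member AND (at least two fat thin
closures, or a thin member missing exactly three points).  The generic part — one fat closure, no thin member
missing three points — is `localShadowHall_three_two_five_generic` at every size.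
-/

namespace PercRepro.Shadow

open Finset PerFlat ThmH

section SevenFiveU

variable {α' : Type} [DecidableEq α']

/-- **THE `(7, 5)` SHADOW ROW FOR EVERY FINITE MATROID MODULO THE RESIDUES U**. -/
theorem shadowHall_seven_five_of_residuesU
    (h20 : ∀ (N : Matroid α') [N.Finite] (G : Finset α'), CellHyp N G →
      (gr N \ G).card = 2 → kColoops N G = 0 → FatMember N G 6 3 →
      (FatBasis N G 6 2 ∨ FatMember N G 6 2) → LocalShadowHall N 5 G)
    (h21 : ∀ (N : Matroid α') [N.Finite] (G : Finset α'), CellHyp N G →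
      (gr N \ G).card = 2 → kColoops N G = 1 → FatMember N G 5 4 →
      (FatBasis N G 5 3 ∨ FatMember N G 5 3) → LocalShadowHall N 5 G)
    (h32 : ∀ (N : Matroid α') [N.Finite] (G : Finset α'), CellHyp N G →
      (gr N \ G).card = 3 → kColoops N G = 2 → FatMember N G 4 2 →
      (2 ≤ (fatClosures N 5 G 2).card ∨ ∃ B ∈ thinMembers N 5 G, (G \ clF N B).card = 3) →
      LocalShadowHall N 5 G)
    (M : Matroid α') [M.Finite] : ShadowHall M 7 5 (phiK 7 5) := by
  apply shadowHall_seven_five_of_residuesT h20 h21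
  intro N _ G hcell hd hk hfm
  by_cases hstr : 2 ≤ (fatClosures N 5 G 2).card ∨ ∃ B ∈ thinMembers N 5 G, (G \ clF N B).card = 3
  · exact h32 N G hcell hd hk hfm hstr
  · push Not at hstr
    have hG := hcell.2.2.2
    have hd' : (gr N \ G).card ≤ 5 := by omega
    obtain ⟨B₀, hB₀, -, hf₀⟩ := hfm
    have hc2 : (G \ clF N B₀).card = 2 := le_antisymm hf₀
      (two_le_card_sdiff_of_not_lay0 hG hd' (mem_thinMembers.1 hB₀).1 (mem_thinMembers.1 hB₀).2)
    obtain ⟨p, x, hpx, hP⟩ := Finset.card_eq_two.1 hc2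
    refine localShadowHall_three_two_five_generic hG hd hk hcell.1 hcell.2.1 (by omega) hstr.2 hpx ?_ ?_
    · intro a ha
      exact notMem_coloops_of_mem_sdiff_clF hG hd' hB₀ (hP ▸ ha)
    · have := eRk_clF_le_of_mem_thinMembers hB₀
      rwa [clF_eq_sdiff_sdiff_of_thin hB₀, hP] at this

end SevenFiveU

end PercRepro.Shadow
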